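import Literature.MathematicalPhysics.QuantumLattice.HubbardTTPrimeCapCutDualRows
import Literature.MathematicalPhysics.QuantumLattice.HubbardNNNHoppingEnergyDensityMonotone
import Literature.MathematicalPhysics.QuantumLattice.HubbardOneBodyKinematicRows
import Literature.MathematicalPhysics.QuantumLattice.BoxDualCovarianceCombination
import HarnessLib

/-!
# Words on a `U`-interval from words at its endpoints / at one anchor: the `U`-direction
# BOX → WORD rules for the `t–t'` Hubbard ground-state data (docc and one-body brackets by
# monotone transport; window certificates by the exact first-order transport identity)

Family `hubbard` (topic `MathematicalPhysics/QuantumLattice`); written for the material-oracle stage S2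
("certified words over parameter BOXES", cell `pub/hubbard-downfold`, seat unc-1 = the `U` direction) on
top of the fast layer's transport calculus, which is CITED and not restated: concavity / monotonicity /
`(n/2)²`-Lipschitz continuity of `U ↦ e(t,t',U,n)` and its chords / tangents
(`HubbardNNNHoppingEnergyDensityConcave/Monotone/RegionBounds`, `HubbardTTPrimeMeanEnergySupergradient`),
the two-state cross-variational monotonicity of the conjugate observables ("T-mono",
`IsTorusLimitOf.docc_le_and_oneBody_le_of_groundStates`) and the docc ceiling `(n/2)²`
(`HubbardTTPrimeCapCutDualRows` §4–§5), and the corner-HULL box certificates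
(`HubbardTTPrimeWindowCertificateConvexComb`, `BoxDualCovarianceCombination`). What this file adds is the
form a box engine consumes — ONE statement per word, uniform over `U ∈ [U₁, U₂]`:

* §1 `energyDensityTT'_mem_Icc_of_mem_Icc_U` — the two-sided ENERGY window on the whole interval from a
  floor at the left end and a cap at the right end (monotonicity in `U`).
* §2 `IsTorusLimitOf.re_expect_docc_mem_Icc_of_mem_Icc_U`, `IsTorusLimitOf.oneBody_mem_Icc_of_mem_Icc_U`
  — DOCC and ONE-BODY-ENERGY brackets valid for every torus-limit ground state at every `U` of the
  interval, from the certified words at the two ENDPOINTS only (`docc ≤ dhi` at `U₁` and `dlo ≤ docc` at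
  `U₂`; `klo ≤ e_{Φ(t,t',0)}` at `U₁` and `e_{Φ(t,t',0)} ≤ khi` at `U₂`): T-mono against an endpoint
  ground state, which exists (`exists_isTorusLimitOf_squareGroundStatesTT'_meanEnergy_eq`).
* §3 `windowCertificate_TT'_transport_U` — the exact TRANSPORT IDENTITY of a `t–t'` window certificate
  along the `U`-ray: since `Φ(t,t',U_A) = Φ(t,t',U_P) + (U_A − U_P) Φ(0,0,1)`
  (`hubbardTTPrimeFermionInteraction_taylor`), an identity issued at `U_A` with objective `X`, constant `c`
  and cap `u` IS an identity at any `U_P` with objective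
  `X + (U_A − U_P)·(κ Γ E_{Φ(0,0,1)} − Σₖ [H_{Λ'}(0,0,1), Γ Bₖ])`, constant `c + κ(u − u')` and cap `u'`
  (same Gram data, same eom generators, same words): the first-order perturbation of the certificate in
  `U` is exact because the interaction is affine in `U`.
* §4 `IsTorusLimitOf.re_expect_ge_of_window_certificate_TT'_ineq_transport_U` — hence ONE certificate at
  `U_A` bounds the objective in every torus-limit ground state `ω` at every `U_P ≥ 0` of the ray with a
  certified cap `e(t,t',U_P,n) ≤ u'`:
  `c + κ(u − u') − Σ‖aₖ‖ + (Σ_σ μ_σ)(n/2 − ν) − (U_A − U_P) κ Re ω(n_{0↑}n_{0↓})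
     + (U_A − U_P) Re ω_{Λ'}(Σₖ [H_{Λ'}(0,0,1), Γ Bₖ]) ≤ Re ω_{Λ'}(X)` —
  the two conjugate terms (the docc density and the "U-charge" of the eom rows) kept EXPLICIT, to be
  priced by the consumer (docc chords of `HubbardTTPrimeCapCutDualRows` §8, a second certificate for the
  charge word, or norms); `…_transport_U_lipschitz` — the norm-priced LIPSCHITZ form
  `… − |U_A − U_P|·(κ (n/2)² + ‖Σₖ [H_{Λ'}(0,0,1), Γ Bₖ]‖) ≤ Re ω_{Λ'}(X)` (`0 ≤ docc ≤ (n/2)²`,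
  `|Re ω(W)| ≤ ‖W‖`); `…_transport_U_box` — the same for every `U_P ∈ [U₁, U₂]`, `0 < U₁`, from ONE cap at
  `U₂` (monotonicity). This is the single-anchor / off-hull complement of the corner-hull box
  certificates (which need certificates at corners on both sides of the target and expand the coupling
  charges on the word dictionary); here nothing but the anchor certificate is used.

HONEST SCOPE: transport lemmas only — no number, no new certificate, no claim on the Hubbard ground
state; the `U(1) × U(1)` charged-word caveat and the translation-only reduction (`γₗ = 1`) of the parent
soundness theorem are unchanged. Everything is PROVED; no definition, no named fact, no numerical input.

## Mathlib / tree search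

REUSED: `ThermodynamicLimit.energyDensityTT'_mono_U`, `exists_isTorusLimitOf_squareGroundStatesTT'_meanEnergy_eq`,
`IsTorusLimitOf.docc_le_and_oneBody_le_of_groundStates`, `IsTorusLimitOf.re_expect_docc_le_sq_half_density_of_groundState`,
`InfVolFermionState.re_expect_docc_nonneg`, `InfVolFermionState.abs_re_expect_le`, `hubbardTTPrimeFermionInteraction_taylor`,
`FermionInteraction.localHamiltonian_of_add_smul_smul`, `FermionInteraction.meanEnergyObs_of_add_smul_smul`,
`IsTorusLimitOf.meanEnergy_onSite_eq_re_expect_docc`, `IsTorusLimitOf.re_expect_ge_of_window_certificate_TT'_ineq`.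
`lean search 'transport.*window_certificate|window_certificate.*transport|mem_Icc.*docc|docc.*mem_Icc_U'`: nothing;
the hull forms `…convexComb…` / `…combination…` / `…cellFloor…` need corner certificates on both sides.

## References

* T. Koma, H. Tasaki, J. Stat. Phys. 76 (1994) 745, §1 (the ground-state energy is concave in a coupling;
  the conjugate observable is monotone along the coupling). [cite: KomaTasaki1994, §1]
* R. B. Griffiths, Phys. Rev. 152 (1966) 240, §II (one-sided derivatives bracket the order parameter of
  every ground state). [cite: Griffiths1966, §II]
* J. Wang et al., PRX 14 (2024) 031006, §III (observable bounds under an energy constraint: every state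
  below the cap satisfying the constraints obeys the certified bound). [cite: WangEtAl2024, §III]
* X. Han, arXiv:2006.06002 (2020), §3 (square-lattice constraint families). [cite: Han2020Bootstrap, §3]
* D. Ruelle, *Statistical Mechanics* (1969), §3.3 (monotonicity / concavity of the ground-state energy
  density in a linear parameter). [cite: Ruelle1969, §3.3]
-/

noncomputable section

namespace Literature.MathematicalPhysics.QuantumLattice

open Matrix Finset HubbardWave0 Literature.Probability.LatticeModels ThermodynamicLimit
open Literature.MathematicalPhysics.QuantumManyBody.StateRelaxation
open _root_.Filter
open scoped _root_.Topology ComplexOrder BigOperators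

/-! ### §1 The energy window on a `U`-interval (monotone transport of floor and cap) -/

namespace ThermodynamicLimit

/-- **Energy window on the whole `U`-interval from its endpoints.** For `0 ≤ U₁ ≤ U₂`, `0 ≤ n < 2`,
a certified floor `l ≤ e(t,t',U₁,n)` at the LEFT end and a certified cap `e(t,t',U₂,n) ≤ r` at the RIGHT
end give `l ≤ e(t,t',U,n) ≤ r` for every `U ∈ [U₁, U₂]` (`U ↦ e` is non-decreasing,
`energyDensityTT'_mono_U`; inside the interval the chord `energyDensityTT'_chord_le` of two endpoint
floors and the tangent caps of `HubbardTTPrimeMeanEnergySupergradient` are sharper). [cite: Ruelle1969, §3.3] -/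
theorem energyDensityTT'_mem_Icc_of_mem_Icc_U (t t' : ℝ) {n : ℝ} (hn0 : 0 ≤ n) (hn2 : n < 2)
    {U₁ U₂ l r : ℝ} (hU₁ : 0 ≤ U₁) (hl : l ≤ energyDensityTT' t t' U₁ n)
    (hr : energyDensityTT' t t' U₂ n ≤ r) {U : ℝ} (hU : U ∈ Set.Icc U₁ U₂) :
    energyDensityTT' t t' U n ∈ Set.Icc l r :=
  ⟨hl.trans (energyDensityTT'_mono_U t t' hn0 hn2 hU₁ hU.1),
    (energyDensityTT'_mono_U t t' hn0 hn2 (hU₁.trans hU.1) hU.2).trans hr⟩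

end ThermodynamicLimit

/-! ### §2 Docc and one-body-energy brackets on a `U`-interval from the two endpoint words -/

namespace InfVolFermionState

/-- **Box docc word from the endpoint words.** Fix `t, t'`, a density `0 ≤ n < 2` and `0 ≤ U₁ ≤ U₂`.
Suppose EVERY torus-limit ground state at `(t,t',U₁)` (torus limit along some `Ls → ∞` of unit
`(rectN n (Ls j), S^z = 0)` sector ground states — the hypothesis class of the certified rows) has
`Re ω(n_{0↑}n_{0↓}) ≤ dhi`, and every torus-limit ground state at `(t,t',U₂)` has
`dlo ≤ Re ω(n_{0↑}n_{0↓})`. Then EVERY torus-limit ground state `ω` at EVERY `U ∈ [U₁, U₂]` has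
`dlo ≤ Re ω(n_{0↑}n_{0↓}) ≤ dhi`: the double occupancy is non-increasing along the `U`-ray for energy
minimisers (T-mono, `IsTorusLimitOf.docc_le_and_oneBody_le_of_groundStates`), compared with an endpoint
ground state, which exists (`exists_isTorusLimitOf_squareGroundStatesTT'_meanEnergy_eq`). The docc
ceiling of the LEFT end and the docc floor of the RIGHT end are the box word; the other two endpoint
numbers do not transport. [cite: KomaTasaki1994, §1] [cite: Griffiths1966, §II] -/
theorem IsTorusLimitOf.re_expect_docc_mem_Icc_of_mem_Icc_U (t t' : ℝ) {U₁ U₂ : ℝ} (hU₁ : 0 ≤ U₁)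
    {n : ℝ} (hn0 : 0 ≤ n) (hn2 : n < 2) {dlo dhi : ℝ}
    (hhi : ∀ (ω : InfVolFermionState 2) (Ls : ℕ → ℕ) (ψ : ∀ L, Fock (Orb (FermionTorus 2 L))),
      Tendsto Ls atTop atTop →
      (∀ j, IsGroundStateInSector (hubbardTorusTT' (Ls j) t t' U₁) (rectN n (Ls j)) 0 (ψ (Ls j))) →
      (∀ j, star (ψ (Ls j)) ⬝ᵥ ψ (Ls j) = 1) → ω.IsTorusLimitOf ψ Ls →
      (ω.expect ({0} : Finset (Site 2))
        (nAt 0 (Finset.mem_singleton_self 0) 0 * nAt 0 (Finset.mem_singleton_self 0) 1)).re ≤ dhi)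
    (hlo : ∀ (ω : InfVolFermionState 2) (Ls : ℕ → ℕ) (ψ : ∀ L, Fock (Orb (FermionTorus 2 L))),
      Tendsto Ls atTop atTop →
      (∀ j, IsGroundStateInSector (hubbardTorusTT' (Ls j) t t' U₂) (rectN n (Ls j)) 0 (ψ (Ls j))) →
      (∀ j, star (ψ (Ls j)) ⬝ᵥ ψ (Ls j) = 1) → ω.IsTorusLimitOf ψ Ls →
      dlo ≤ (ω.expect ({0} : Finset (Site 2))
        (nAt 0 (Finset.mem_singleton_self 0) 0 * nAt 0 (Finset.mem_singleton_self 0) 1)).re)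
    {U : ℝ} (hU : U ∈ Set.Icc U₁ U₂)
    {ω : InfVolFermionState 2} {ψ : ∀ L, Fock (Orb (FermionTorus 2 L))} {Ls : ℕ → ℕ}
    (h : ω.IsTorusLimitOf ψ Ls) (hLs : Tendsto Ls atTop atTop)
    (hψ : ∀ j, IsGroundStateInSector (hubbardTorusTT' (Ls j) t t' U) (rectN n (Ls j)) 0 (ψ (Ls j)))
    (h1 : ∀ j, star (ψ (Ls j)) ⬝ᵥ ψ (Ls j) = 1) :
    dlo ≤ (ω.expect ({0} : Finset (Site 2))
        (nAt 0 (Finset.mem_singleton_self 0) 0 * nAt 0 (Finset.mem_singleton_self 0) 1)).re ∧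
      (ω.expect ({0} : Finset (Site 2))
        (nAt 0 (Finset.mem_singleton_self 0) 0 * nAt 0 (Finset.mem_singleton_self 0) 1)).re ≤ dhi := by
  have hU0 : 0 ≤ U := hU₁.trans hU.1
  refine ⟨?_, ?_⟩
  · -- floor: compare with a ground state at the right end `U₂ ≥ U`
    rcases eq_or_lt_of_le hU.2 with heq | hlt
    · subst heq
      exact hlo ω Ls ψ hLs hψ h1 h
    · obtain ⟨ψ₂, Ls₂, ω₂, hLs₂, hω₂, -, -, h1₂, hψ₂, -, -, -⟩ :=
        exists_isTorusLimitOf_squareGroundStatesTT'_meanEnergy_eq t t' (hU0.trans hlt.le) hn0 hn2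
      have hmono := (h.docc_le_and_oneBody_le_of_groundStates t t' hU0 hlt hn0 hn2 hLs hψ h1 hω₂ hLs₂
        hψ₂ h1₂).1
      exact (hlo ω₂ Ls₂ ψ₂ hLs₂ hψ₂ h1₂ hω₂).trans hmono
  · -- ceiling: compare with a ground state at the left end `U₁ ≤ U`
    rcases eq_or_lt_of_le hU.1 with heq | hlt
    · subst heq
      exact hhi ω Ls ψ hLs hψ h1 h
    · obtain ⟨ψ₁, Ls₁, ω₁, hLs₁, hω₁, -, -, h1₁, hψ₁, -, -, -⟩ :=
        exists_isTorusLimitOf_squareGroundStatesTT'_meanEnergy_eq t t' hU₁ hn0 hn2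
      have hmono := (hω₁.docc_le_and_oneBody_le_of_groundStates t t' hU₁ hlt hn0 hn2 hLs₁ hψ₁ h1₁ h hLs
        hψ h1).1
      exact hmono.trans (hhi ω₁ Ls₁ ψ₁ hLs₁ hψ₁ h1₁ hω₁)

/-- **Box one-body word from the endpoint words.** With the same hypothesis class: if every torus-limit
ground state at `(t,t',U₁)` has one-body (kinetic, `t T + t' T'`) energy per site
`klo ≤ e_{Φ(t,t',0)}(ω)` and every torus-limit ground state at `(t,t',U₂)` has `e_{Φ(t,t',0)}(ω) ≤ khi`,
then every torus-limit ground state at every `U ∈ [U₁, U₂]` (`0 ≤ U₁`) has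
`klo ≤ e_{Φ(t,t',0)}(ω) ≤ khi`: the one-body energy is non-decreasing along the `U`-ray for energy
minimisers (T-mono). A kinetic CEILING `−e_{Φ(t,t',0)} ≤ −klo` certified at the left end — the input of
the flux/stiffness bounds — is therefore the box word of the whole interval to its right.
[cite: KomaTasaki1994, §1] [cite: Griffiths1966, §II] -/
theorem IsTorusLimitOf.oneBody_mem_Icc_of_mem_Icc_U (t t' : ℝ) {U₁ U₂ : ℝ} (hU₁ : 0 ≤ U₁)
    {n : ℝ} (hn0 : 0 ≤ n) (hn2 : n < 2) {klo khi : ℝ}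
    (hlo : ∀ (ω : InfVolFermionState 2) (Ls : ℕ → ℕ) (ψ : ∀ L, Fock (Orb (FermionTorus 2 L))),
      Tendsto Ls atTop atTop →
      (∀ j, IsGroundStateInSector (hubbardTorusTT' (Ls j) t t' U₁) (rectN n (Ls j)) 0 (ψ (Ls j))) →
      (∀ j, star (ψ (Ls j)) ⬝ᵥ ψ (Ls j) = 1) → ω.IsTorusLimitOf ψ Ls →
      klo ≤ ω.meanEnergy (hubbardTTPrimeFermionInteraction t t' 0) 1)
    (hhi : ∀ (ω : InfVolFermionState 2) (Ls : ℕ → ℕ) (ψ : ∀ L, Fock (Orb (FermionTorus 2 L))),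
      Tendsto Ls atTop atTop →
      (∀ j, IsGroundStateInSector (hubbardTorusTT' (Ls j) t t' U₂) (rectN n (Ls j)) 0 (ψ (Ls j))) →
      (∀ j, star (ψ (Ls j)) ⬝ᵥ ψ (Ls j) = 1) → ω.IsTorusLimitOf ψ Ls →
      ω.meanEnergy (hubbardTTPrimeFermionInteraction t t' 0) 1 ≤ khi)
    {U : ℝ} (hU : U ∈ Set.Icc U₁ U₂)
    {ω : InfVolFermionState 2} {ψ : ∀ L, Fock (Orb (FermionTorus 2 L))} {Ls : ℕ → ℕ}
    (h : ω.IsTorusLimitOf ψ Ls) (hLs : Tendsto Ls atTop atTop)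
    (hψ : ∀ j, IsGroundStateInSector (hubbardTorusTT' (Ls j) t t' U) (rectN n (Ls j)) 0 (ψ (Ls j)))
    (h1 : ∀ j, star (ψ (Ls j)) ⬝ᵥ ψ (Ls j) = 1) :
    klo ≤ ω.meanEnergy (hubbardTTPrimeFermionInteraction t t' 0) 1 ∧
      ω.meanEnergy (hubbardTTPrimeFermionInteraction t t' 0) 1 ≤ khi := by
  have hU0 : 0 ≤ U := hU₁.trans hU.1
  refine ⟨?_, ?_⟩
  · -- floor: compare with a ground state at the left end `U₁ ≤ U`
    rcases eq_or_lt_of_le hU.1 with heq | hlt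
    · subst heq
      exact hlo ω Ls ψ hLs hψ h1 h
    · obtain ⟨ψ₁, Ls₁, ω₁, hLs₁, hω₁, -, -, h1₁, hψ₁, -, -, -⟩ :=
        exists_isTorusLimitOf_squareGroundStatesTT'_meanEnergy_eq t t' hU₁ hn0 hn2
      have hmono := (hω₁.docc_le_and_oneBody_le_of_groundStates t t' hU₁ hlt hn0 hn2 hLs₁ hψ₁ h1₁ h hLs
        hψ h1).2
      exact (hlo ω₁ Ls₁ ψ₁ hLs₁ hψ₁ h1₁ hω₁).trans hmono
  · -- ceiling: compare with a ground state at the right end `U₂ ≥ U`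
    rcases eq_or_lt_of_le hU.2 with heq | hlt
    · subst heq
      exact hhi ω Ls ψ hLs hψ h1 h
    · obtain ⟨ψ₂, Ls₂, ω₂, hLs₂, hω₂, -, -, h1₂, hψ₂, -, -, -⟩ :=
        exists_isTorusLimitOf_squareGroundStatesTT'_meanEnergy_eq t t' (hU0.trans hlt.le) hn0 hn2
      have hmono := (h.docc_le_and_oneBody_le_of_groundStates t t' hU0 hlt hn0 hn2 hLs hψ h1 hω₂ hLs₂
        hψ₂ h1₂).2
      exact hmono.trans (hhi ω₂ Ls₂ ψ₂ hLs₂ hψ₂ h1₂ hω₂)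

end InfVolFermionState

/-! ### §3 The exact transport identity of a window certificate along the `U`-ray -/

/-- **`U`-transport identity of a `t–t'` window certificate.** Let a window identity hold in `𝔄_{Λ'}` at
the anchor coupling `(t, t', U_A)`: objective `Xw`, constant `c`, density terms `Σ_σ μ_σ (n_{0σ} − ν)`,
energy term `κ (u·1 − Γ E_{Φ(t,t',U_A)})`, Gram part `G`, eom rows `Σₖ (H_{Λ'}(t,t',U_A) ΓBₖ − ΓBₖ H_{Λ'}(t,t',U_A))`
and coupling-independent blocks `SY` (symmetry defects and charged words) and `R` (anti-Hermitian parts and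
residual words). Since `Φ(t,t',U_A) = Φ(t,t',U_P) + (U_A − U_P) Φ(0,0,1)` pointwise, for EVERY `U_P` and
EVERY cap `u'` the same data form a window identity at `(t, t', U_P)` with objective
`Xw + (U_A − U_P)·(κ Γ E_{Φ(0,0,1)} − Σₖ (H_{Λ'}(0,0,1) ΓBₖ − ΓBₖ H_{Λ'}(0,0,1)))`, constant `c + κ (u − u')`
and cap `u'` (exact first-order perturbation of the certificate in `U`). [cite: WangEtAl2024, §III] -/
theorem windowCertificate_TT'_transport_U (t t' UA UP : ℝ)
    {Λ Λ' : Finset (Site 2)} (hΛ : Λ ⊆ Λ') (h0 : thicken ({0} : Finset (Site 2)) 1 ⊆ Λ')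
    (hz : (0 : Site 2) ∈ Λ') (Xw : FermionOp Λ') (κ u u' : ℝ) (μ : Fin 2 → ℝ) (ν : ℝ)
    (G SY R : FermionOp Λ') {κ' : Type*} (s : Finset κ') (B : κ' → FermionOp Λ) {c : ℝ}
    (hcert : Xw - (c : ℂ) • (1 : FermionOp Λ') -
        ∑ σ : Fin 2, ((μ σ : ℝ) : ℂ) • (nAt 0 hz σ - ((ν : ℝ) : ℂ) • (1 : FermionOp Λ')) -
        ((κ : ℝ) : ℂ) • (((u : ℝ) : ℂ) • (1 : FermionOp Λ') -
          fermionEmbed (PolySite.incl h0) ((hubbardTTPrimeFermionInteraction t t' UA).meanEnergyObs 1)) =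
      G +
        (∑ k ∈ s, ((hubbardTTPrimeFermionInteraction t t' UA).localHamiltonian Λ' *
              fermionEmbed (PolySite.incl hΛ) (B k) -
            fermionEmbed (PolySite.incl hΛ) (B k) * (hubbardTTPrimeFermionInteraction t t' UA).localHamiltonian Λ') +
          SY) + R) :
    (Xw + ((UA - UP : ℝ) : ℂ) •
        (((κ : ℝ) : ℂ) • fermionEmbed (PolySite.incl h0) ((hubbardTTPrimeFermionInteraction 0 0 1).meanEnergyObs 1) -
          ∑ k ∈ s, ((hubbardTTPrimeFermionInteraction 0 0 1).localHamiltonian Λ' *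
              fermionEmbed (PolySite.incl hΛ) (B k) -
            fermionEmbed (PolySite.incl hΛ) (B k) * (hubbardTTPrimeFermionInteraction 0 0 1).localHamiltonian Λ'))) -
        ((c + κ * (u - u') : ℝ) : ℂ) • (1 : FermionOp Λ') -
        ∑ σ : Fin 2, ((μ σ : ℝ) : ℂ) • (nAt 0 hz σ - ((ν : ℝ) : ℂ) • (1 : FermionOp Λ')) -
        ((κ : ℝ) : ℂ) • (((u' : ℝ) : ℂ) • (1 : FermionOp Λ') -
          fermionEmbed (PolySite.incl h0) ((hubbardTTPrimeFermionInteraction t t' UP).meanEnergyObs 1)) =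
      G +
        (∑ k ∈ s, ((hubbardTTPrimeFermionInteraction t t' UP).localHamiltonian Λ' *
              fermionEmbed (PolySite.incl hΛ) (B k) -
            fermionEmbed (PolySite.incl hΛ) (B k) * (hubbardTTPrimeFermionInteraction t t' UP).localHamiltonian Λ') +
          SY) + R := by
  -- the interaction at the anchor, expanded at the target
  have hΦ : ∀ X, (hubbardTTPrimeFermionInteraction t t' UA).Φ X =
      (hubbardTTPrimeFermionInteraction t t' UP).Φ X +
        ((t' - t' : ℝ) : ℂ) • (hubbardTTPrimeFermionInteraction 0 1 0).Φ X +
        ((UA - UP : ℝ) : ℂ) • (hubbardTTPrimeFermionInteraction 0 0 1).Φ X :=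
    fun X => hubbardTTPrimeFermionInteraction_taylor t t' UA t' UP X
  have hH := FermionInteraction.localHamiltonian_of_add_smul_smul hΦ Λ'
  have hE := FermionInteraction.meanEnergyObs_of_add_smul_smul hΦ 1
  rw [sub_self, Complex.ofReal_zero, zero_smul, add_zero] at hH hE
  -- abbreviations
  set HP : FermionOp Λ' := (hubbardTTPrimeFermionInteraction t t' UP).localHamiltonian Λ' with hHP
  set HD : FermionOp Λ' := (hubbardTTPrimeFermionInteraction 0 0 1).localHamiltonian Λ' with hHD
  set EP := (hubbardTTPrimeFermionInteraction t t' UP).meanEnergyObs 1 with hEP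
  set ED := (hubbardTTPrimeFermionInteraction 0 0 1).meanEnergyObs 1 with hED
  set b : ℂ := ((UA - UP : ℝ) : ℂ) with hb
  -- the eom block splits
  have hN : ∑ k ∈ s, ((hubbardTTPrimeFermionInteraction t t' UA).localHamiltonian Λ' *
        fermionEmbed (PolySite.incl hΛ) (B k) -
      fermionEmbed (PolySite.incl hΛ) (B k) * (hubbardTTPrimeFermionInteraction t t' UA).localHamiltonian Λ') =
      ∑ k ∈ s, (HP * fermionEmbed (PolySite.incl hΛ) (B k) - fermionEmbed (PolySite.incl hΛ) (B k) * HP) +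
        b • ∑ k ∈ s, (HD * fermionEmbed (PolySite.incl hΛ) (B k) - fermionEmbed (PolySite.incl hΛ) (B k) * HD) := by
    rw [Finset.smul_sum, ← Finset.sum_add_distrib]
    refine Finset.sum_congr rfl fun k _ => ?_
    rw [hH]
    simp only [add_mul, mul_add, smul_mul_assoc, mul_smul_comm, smul_sub]
    abel
  rw [hN, hE, map_add, map_smul] at hcert
  -- regroup: the target identity is the anchor identity with the two conjugate terms moved to the left
  have key : Xw + b • (((κ : ℝ) : ℂ) • fermionEmbed (PolySite.incl h0) ED -
          ∑ k ∈ s, (HD * fermionEmbed (PolySite.incl hΛ) (B k) - fermionEmbed (PolySite.incl hΛ) (B k) * HD)) -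
        ((c + κ * (u - u') : ℝ) : ℂ) • (1 : FermionOp Λ') -
        ∑ σ : Fin 2, ((μ σ : ℝ) : ℂ) • (nAt 0 hz σ - ((ν : ℝ) : ℂ) • (1 : FermionOp Λ')) -
        ((κ : ℝ) : ℂ) • (((u' : ℝ) : ℂ) • (1 : FermionOp Λ') - fermionEmbed (PolySite.incl h0) EP) =
      (Xw - (c : ℂ) • (1 : FermionOp Λ') -
        ∑ σ : Fin 2, ((μ σ : ℝ) : ℂ) • (nAt 0 hz σ - ((ν : ℝ) : ℂ) • (1 : FermionOp Λ')) -
        ((κ : ℝ) : ℂ) • (((u : ℝ) : ℂ) • (1 : FermionOp Λ') -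
          (fermionEmbed (PolySite.incl h0) EP + b • fermionEmbed (PolySite.incl h0) ED))) -
        b • ∑ k ∈ s, (HD * fermionEmbed (PolySite.incl hΛ) (B k) - fermionEmbed (PolySite.incl hΛ) (B k) * HD) := by
    push_cast
    module
  rw [key, hcert]
  module

/-! ### §4 One certificate at `U_A` bounds the objective in the ground states at every `U_P` of the ray -/

namespace InfVolFermionState

/-- **`U`-transport of a translation-reduced `t–t'` window certificate to the torus-limit ground states at
another coupling.** Data: the window identity of
`IsTorusLimitOf.re_expect_ge_of_window_certificate_TT'_ineq` issued at the ANCHOR `(t, t', U_A)`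
(objective `Xw`, constant `c`, cap `u`, multiplier `κ ≥ 0`, all point-group labels `γₗ = 1`). Let
`U_P ≥ 0`, `0 ≤ n < 2`, `u'` a certified cap `e(t,t',U_P,n) ≤ u'`, and `ω` a torus limit of unit
`(rectN n (Ls j), S^z = 0)` sector ground states of `hubbardTorusTT' (Ls j) t t' U_P` along `Ls → ∞`. Then
`c + κ(u − u') − Σₖ ‖aₖ‖ + (Σ_σ μ_σ)(n/2 − ν) − (U_A − U_P)·κ·Re ω(n_{0↑}n_{0↓})
   + (U_A − U_P)·Re ω_{Λ'}(Σₖ (H_{Λ'}(0,0,1) ΓBₖ − ΓBₖ H_{Λ'}(0,0,1))) ≤ Re ω_{Λ'}(Xw)`: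
the transported identity (`windowCertificate_TT'_transport_U`) is a window identity AT `U_P`, to which
the tree's soundness theorem applies; its objective is read in `ω` (`ω(Γ E_{Φ(0,0,1)}) = Re ω(n_{0↑}n_{0↓})`,
`IsTorusLimitOf.meanEnergy_onSite_eq_re_expect_docc`). With `U_P = U_A`, `u' = u` this is the parent
theorem. [cite: WangEtAl2024, §III] [cite: KomaTasaki1994, §1] -/
theorem IsTorusLimitOf.re_expect_ge_of_window_certificate_TT'_ineq_transport_U
    (t t' UA : ℝ) {UP : ℝ} (hUP : 0 ≤ UP) {n : ℝ} (hn0 : 0 ≤ n) (hn2 : n < 2) {κ u u' : ℝ} (hκ : 0 ≤ κ)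
    (hu' : ThermodynamicLimit.energyDensityTT' t t' UP n ≤ u')
    {Λ Λ' : Finset (Site 2)} (hΛ : Λ ⊆ Λ') (h8 : thicken Λ 1 ⊆ Λ')
    (h0 : thicken ({0} : Finset (Site 2)) 1 ⊆ Λ') (hz : (0 : Site 2) ∈ Λ')
    (Xw : FermionOp Λ') (μ : Fin 2 → ℝ) (ν : ℝ)
    {m : Type*} [Fintype m] [DecidableEq m] {Λm : Matrix m m ℂ} (hΛm : Λm.PosSemidef)
    (O : m → FermionOp Λ')
    {κ' : Type*} (s : Finset κ') (B : κ' → FermionOp Λ)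
    {ι : Type*} (tt : Finset ι) (γ : ι → DihedralGroup 4) (hγ1 : ∀ l ∈ tt, γ l = 1) (wv : ι → Site 2)
    (hsh : ∀ l, d4ShiftSet (γ l) (wv l) Λ ⊆ Λ') (Y : ι → FermionOp Λ)
    {ρ : Type*} (uu : Finset ρ) (b : ρ → ℂ) (cw : ρ → List (Orb (PolySite Λ') × Bool))
    (hcw : ∀ j ∈ uu, ladderCharge (cw j) ≠ 0 ∨ ladderSpinCharge (cw j) ≠ 0)
    {δ : Type*} (ah : Finset δ) (dc : δ → ℝ) (V : δ → FermionOp Λ')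
    {κ'' : Type*} (w : Finset κ'') (a : κ'' → ℂ) (word : κ'' → List (Orb (PolySite Λ') × Bool)) {c : ℝ}
    (hcert : Xw - (c : ℂ) • (1 : FermionOp Λ') -
        ∑ σ : Fin 2, ((μ σ : ℝ) : ℂ) • (nAt 0 hz σ - ((ν : ℝ) : ℂ) • (1 : FermionOp Λ')) -
        ((κ : ℝ) : ℂ) • (((u : ℝ) : ℂ) • (1 : FermionOp Λ') -
          fermionEmbed (PolySite.incl h0) ((hubbardTTPrimeFermionInteraction t t' UA).meanEnergyObs 1)) =
      gramForm Λm O +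
        (∑ k ∈ s, ((hubbardTTPrimeFermionInteraction t t' UA).localHamiltonian Λ' * fermionEmbed (PolySite.incl hΛ) (B k) -
            fermionEmbed (PolySite.incl hΛ) (B k) * (hubbardTTPrimeFermionInteraction t t' UA).localHamiltonian Λ') +
          ∑ l ∈ tt, (fermionEmbed (PolySite.incl (hsh l)) (fermionEmbed (PolySite.d4Emb (γ l) (wv l) Λ) (Y l)) -
            fermionEmbed (PolySite.incl hΛ) (Y l)) +
          ∑ j ∈ uu, b j • ladderWord (cw j)) +
        (∑ m' ∈ ah, ((dc m' : ℝ) : ℂ) • ((V m')ᴴ - V m') + ∑ k ∈ w, a k • ladderWord (word k)))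
    {Ls : ℕ → ℕ} (hLs : Tendsto Ls atTop atTop)
    {ψ : ∀ L, Fock (Orb (FermionTorus 2 L))}
    (hψ : ∀ j, IsGroundStateInSector (hubbardTorusTT' (Ls j) t t' UP)
      (ThermodynamicLimit.rectN n (Ls j)) 0 (ψ (Ls j)))
    (hψ1 : ∀ j, star (ψ (Ls j)) ⬝ᵥ ψ (Ls j) = 1)
    {ω : InfVolFermionState 2} (hω : ω.IsTorusLimitOf ψ Ls) :
    c + κ * (u - u') - ∑ k ∈ w, ‖a k‖ + (∑ σ : Fin 2, μ σ) * (n / 2 - ν) -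
        (UA - UP) * κ * (ω.expect ({0} : Finset (Site 2))
          (nAt 0 (Finset.mem_singleton_self 0) 0 * nAt 0 (Finset.mem_singleton_self 0) 1)).re +
        (UA - UP) * (ω.expect Λ' (∑ k ∈ s,
          ((hubbardTTPrimeFermionInteraction 0 0 1).localHamiltonian Λ' * fermionEmbed (PolySite.incl hΛ) (B k) -
            fermionEmbed (PolySite.incl hΛ) (B k) * (hubbardTTPrimeFermionInteraction 0 0 1).localHamiltonian Λ'))).re ≤
      (ω.expect Λ' Xw).re := by
  -- the transported identity at `U_P`
  have hcert' := windowCertificate_TT'_transport_U t t' UA UP hΛ h0 hz Xw κ u u' μ ν (gramForm Λm O)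
    (∑ l ∈ tt, (fermionEmbed (PolySite.incl (hsh l)) (fermionEmbed (PolySite.d4Emb (γ l) (wv l) Λ) (Y l)) -
        fermionEmbed (PolySite.incl hΛ) (Y l)) +
      ∑ j ∈ uu, b j • ladderWord (cw j))
    (∑ m' ∈ ah, ((dc m' : ℝ) : ℂ) • ((V m')ᴴ - V m') + ∑ k ∈ w, a k • ladderWord (word k)) s B
    (c := c) (by rw [hcert]; abel)
  -- the tree's soundness theorem at `U_P`, applied to the transported identity
  have hmain := hω.re_expect_ge_of_window_certificate_TT'_ineq t t' hUP hn0 hn2 hκ hu' hΛ h8 h0 hz _ μ ν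
    hΛm O s B tt γ hγ1 wv hsh Y uu b cw hcw ah dc V w a word (c := c + κ * (u - u'))
    (by rw [hcert']; abel) hLs hψ hψ1
  -- read the transported objective in `ω`
  have hED : (ω.expect Λ' (fermionEmbed (PolySite.incl h0)
      ((hubbardTTPrimeFermionInteraction 0 0 1).meanEnergyObs 1))).re =
      (ω.expect ({0} : Finset (Site 2))
        (nAt 0 (Finset.mem_singleton_self 0) 0 * nAt 0 (Finset.mem_singleton_self 0) 1)).re := by
    rw [ω.compatible h0, ← hω.meanEnergy_onSite_eq_re_expect_docc hLs]
    rfl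
  have hread : (ω.expect Λ' (Xw + ((UA - UP : ℝ) : ℂ) •
      (((κ : ℝ) : ℂ) • fermionEmbed (PolySite.incl h0) ((hubbardTTPrimeFermionInteraction 0 0 1).meanEnergyObs 1) -
        ∑ k ∈ s, ((hubbardTTPrimeFermionInteraction 0 0 1).localHamiltonian Λ' * fermionEmbed (PolySite.incl hΛ) (B k) -
          fermionEmbed (PolySite.incl hΛ) (B k) * (hubbardTTPrimeFermionInteraction 0 0 1).localHamiltonian Λ')))).re =
      (ω.expect Λ' Xw).re + (UA - UP) * (κ * (ω.expect ({0} : Finset (Site 2))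
          (nAt 0 (Finset.mem_singleton_self 0) 0 * nAt 0 (Finset.mem_singleton_self 0) 1)).re -
        (ω.expect Λ' (∑ k ∈ s,
          ((hubbardTTPrimeFermionInteraction 0 0 1).localHamiltonian Λ' * fermionEmbed (PolySite.incl hΛ) (B k) -
            fermionEmbed (PolySite.incl hΛ) (B k) * (hubbardTTPrimeFermionInteraction 0 0 1).localHamiltonian Λ'))).re) := by
    rw [map_add, Complex.add_re, map_smul, smul_eq_mul, Complex.re_ofReal_mul, map_sub, Complex.sub_re,
      map_smul, smul_eq_mul, Complex.re_ofReal_mul, hED]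
  rw [hread] at hmain
  linarith

open scoped Matrix.Norms.L2Operator in
/-- **The norm-priced LIPSCHITZ form.** Under the hypotheses of
`…re_expect_ge_of_window_certificate_TT'_ineq_transport_U` with `U_P > 0`:
`c + κ(u − u') − Σₖ ‖aₖ‖ + (Σ_σ μ_σ)(n/2 − ν) − |U_A − U_P|·(κ (n/2)² + ‖Σₖ (H_{Λ'}(0,0,1) ΓBₖ − ΓBₖ H_{Λ'}(0,0,1))‖)
   ≤ Re ω_{Λ'}(Xw)` — the docc term priced by `0 ≤ Re ω(n_{0↑}n_{0↓}) ≤ (n/2)²`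
(`re_expect_docc_nonneg`, `IsTorusLimitOf.re_expect_docc_le_sq_half_density_of_groundState`) and the
`U`-charge of the eom rows by the operator norm (`abs_re_expect_le`). The bracket
`κ (n/2)² + ‖Σₖ [H_{Λ'}(0,0,1), ΓBₖ]‖` is a certified Lipschitz constant in `U` of the word the anchor
certificate proves (the cap must still hold at `U_P`). [cite: WangEtAl2024, §III] [cite: KomaTasaki1994, §1] -/
theorem IsTorusLimitOf.re_expect_ge_of_window_certificate_TT'_ineq_transport_U_lipschitz
    (t t' UA : ℝ) {UP : ℝ} (hUP : 0 < UP) {n : ℝ} (hn0 : 0 ≤ n) (hn2 : n < 2) {κ u u' : ℝ} (hκ : 0 ≤ κ)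
    (hu' : ThermodynamicLimit.energyDensityTT' t t' UP n ≤ u')
    {Λ Λ' : Finset (Site 2)} (hΛ : Λ ⊆ Λ') (h8 : thicken Λ 1 ⊆ Λ')
    (h0 : thicken ({0} : Finset (Site 2)) 1 ⊆ Λ') (hz : (0 : Site 2) ∈ Λ')
    (Xw : FermionOp Λ') (μ : Fin 2 → ℝ) (ν : ℝ)
    {m : Type*} [Fintype m] [DecidableEq m] {Λm : Matrix m m ℂ} (hΛm : Λm.PosSemidef)
    (O : m → FermionOp Λ')
    {κ' : Type*} (s : Finset κ') (B : κ' → FermionOp Λ)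
    {ι : Type*} (tt : Finset ι) (γ : ι → DihedralGroup 4) (hγ1 : ∀ l ∈ tt, γ l = 1) (wv : ι → Site 2)
    (hsh : ∀ l, d4ShiftSet (γ l) (wv l) Λ ⊆ Λ') (Y : ι → FermionOp Λ)
    {ρ : Type*} (uu : Finset ρ) (b : ρ → ℂ) (cw : ρ → List (Orb (PolySite Λ') × Bool))
    (hcw : ∀ j ∈ uu, ladderCharge (cw j) ≠ 0 ∨ ladderSpinCharge (cw j) ≠ 0)
    {δ : Type*} (ah : Finset δ) (dc : δ → ℝ) (V : δ → FermionOp Λ')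
    {κ'' : Type*} (w : Finset κ'') (a : κ'' → ℂ) (word : κ'' → List (Orb (PolySite Λ') × Bool)) {c : ℝ}
    (hcert : Xw - (c : ℂ) • (1 : FermionOp Λ') -
        ∑ σ : Fin 2, ((μ σ : ℝ) : ℂ) • (nAt 0 hz σ - ((ν : ℝ) : ℂ) • (1 : FermionOp Λ')) -
        ((κ : ℝ) : ℂ) • (((u : ℝ) : ℂ) • (1 : FermionOp Λ') -
          fermionEmbed (PolySite.incl h0) ((hubbardTTPrimeFermionInteraction t t' UA).meanEnergyObs 1)) =
      gramForm Λm O +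
        (∑ k ∈ s, ((hubbardTTPrimeFermionInteraction t t' UA).localHamiltonian Λ' * fermionEmbed (PolySite.incl hΛ) (B k) -
            fermionEmbed (PolySite.incl hΛ) (B k) * (hubbardTTPrimeFermionInteraction t t' UA).localHamiltonian Λ') +
          ∑ l ∈ tt, (fermionEmbed (PolySite.incl (hsh l)) (fermionEmbed (PolySite.d4Emb (γ l) (wv l) Λ) (Y l)) -
            fermionEmbed (PolySite.incl hΛ) (Y l)) +
          ∑ j ∈ uu, b j • ladderWord (cw j)) +
        (∑ m' ∈ ah, ((dc m' : ℝ) : ℂ) • ((V m')ᴴ - V m') + ∑ k ∈ w, a k • ladderWord (word k)))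
    {Ls : ℕ → ℕ} (hLs : Tendsto Ls atTop atTop)
    {ψ : ∀ L, Fock (Orb (FermionTorus 2 L))}
    (hψ : ∀ j, IsGroundStateInSector (hubbardTorusTT' (Ls j) t t' UP)
      (ThermodynamicLimit.rectN n (Ls j)) 0 (ψ (Ls j)))
    (hψ1 : ∀ j, star (ψ (Ls j)) ⬝ᵥ ψ (Ls j) = 1)
    {ω : InfVolFermionState 2} (hω : ω.IsTorusLimitOf ψ Ls) :
    c + κ * (u - u') - ∑ k ∈ w, ‖a k‖ + (∑ σ : Fin 2, μ σ) * (n / 2 - ν) -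
        |UA - UP| * (κ * (n / 2) ^ 2 + ‖∑ k ∈ s,
          ((hubbardTTPrimeFermionInteraction 0 0 1).localHamiltonian Λ' * fermionEmbed (PolySite.incl hΛ) (B k) -
            fermionEmbed (PolySite.incl hΛ) (B k) * (hubbardTTPrimeFermionInteraction 0 0 1).localHamiltonian Λ')‖) ≤
      (ω.expect Λ' Xw).re := by
  have h := hω.re_expect_ge_of_window_certificate_TT'_ineq_transport_U t t' UA hUP.le hn0 hn2 hκ hu' hΛ h8 h0
    hz Xw μ ν hΛm O s B tt γ hγ1 wv hsh Y uu b cw hcw ah dc V w a word hcert hLs hψ hψ1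
  set d := (ω.expect ({0} : Finset (Site 2))
    (nAt 0 (Finset.mem_singleton_self 0) 0 * nAt 0 (Finset.mem_singleton_self 0) 1)).re with hd
  set W : FermionOp Λ' := ∑ k ∈ s,
    ((hubbardTTPrimeFermionInteraction 0 0 1).localHamiltonian Λ' * fermionEmbed (PolySite.incl hΛ) (B k) -
      fermionEmbed (PolySite.incl hΛ) (B k) * (hubbardTTPrimeFermionInteraction 0 0 1).localHamiltonian Λ') with hW
  have hd0 : 0 ≤ d := ω.re_expect_docc_nonneg
  have hd1 : d ≤ (n / 2) ^ 2 :=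
    hω.re_expect_docc_le_sq_half_density_of_groundState t t' hUP hn0 hn2 hLs hψ hψ1
  have hWn : |(ω.expect Λ' W).re| ≤ ‖W‖ := ω.abs_re_expect_le Λ' W
  -- the docc term: `-(UA-UP) κ d ≥ -|UA-UP| κ (n/2)²`
  have hD : -(|UA - UP| * (κ * (n / 2) ^ 2)) ≤ -((UA - UP) * κ * d) := by
    rcases le_total 0 (UA - UP) with hp | hm
    · rw [abs_of_nonneg hp]
      nlinarith [mul_nonneg hp hκ, mul_le_mul_of_nonneg_left hd1 (mul_nonneg hp hκ)]
    · rw [abs_of_nonpos hm]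
      nlinarith [mul_nonneg (neg_nonneg.2 hm) hκ, mul_nonneg (mul_nonneg (neg_nonneg.2 hm) hκ) hd0,
        mul_nonneg (mul_nonneg (neg_nonneg.2 hm) hκ) (sq_nonneg (n / 2))]
  -- the charge term: `(UA-UP) Re ω(W) ≥ -|UA-UP| ‖W‖`
  have hC : -(|UA - UP| * ‖W‖) ≤ (UA - UP) * (ω.expect Λ' W).re := by
    have h1 : |(UA - UP) * (ω.expect Λ' W).re| ≤ |UA - UP| * ‖W‖ := by
      rw [abs_mul]
      exact mul_le_mul_of_nonneg_left hWn (abs_nonneg _)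
    exact (abs_le.1 h1).1
  nlinarith [hD, hC]

open scoped Matrix.Norms.L2Operator in
/-- **Box form: one anchor certificate, every `U` of an interval.** Under the hypotheses of
`…_transport_U_lipschitz`, for `0 < U₁ ≤ U₂`, ONE certified cap at the right end
`e(t,t',U₂,n) ≤ u'` (hence at every `U_P ≤ U₂`, `energyDensityTT'_mono_U`) and every torus-limit ground
state `ω` at any `U_P ∈ [U₁, U₂]`:
`c + κ(u − u') − Σₖ ‖aₖ‖ + (Σ_σ μ_σ)(n/2 − ν) − |U_A − U_P|·(κ (n/2)² + ‖Σₖ [H_{Λ'}(0,0,1), ΓBₖ]‖) ≤ Re ω_{Λ'}(Xw)`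
— the anchor `U_A` need not lie in the interval (off-hull transport). [cite: WangEtAl2024, §III] [cite: KomaTasaki1994, §1] -/
theorem IsTorusLimitOf.re_expect_ge_of_window_certificate_TT'_ineq_transport_U_box
    (t t' UA : ℝ) {U₁ U₂ : ℝ} (hU₁ : 0 < U₁) {n : ℝ} (hn0 : 0 ≤ n) (hn2 : n < 2) {κ u u' : ℝ}
    (hκ : 0 ≤ κ) (hu' : ThermodynamicLimit.energyDensityTT' t t' U₂ n ≤ u')
    {Λ Λ' : Finset (Site 2)} (hΛ : Λ ⊆ Λ') (h8 : thicken Λ 1 ⊆ Λ')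
    (h0 : thicken ({0} : Finset (Site 2)) 1 ⊆ Λ') (hz : (0 : Site 2) ∈ Λ')
    (Xw : FermionOp Λ') (μ : Fin 2 → ℝ) (ν : ℝ)
    {m : Type*} [Fintype m] [DecidableEq m] {Λm : Matrix m m ℂ} (hΛm : Λm.PosSemidef)
    (O : m → FermionOp Λ')
    {κ' : Type*} (s : Finset κ') (B : κ' → FermionOp Λ)
    {ι : Type*} (tt : Finset ι) (γ : ι → DihedralGroup 4) (hγ1 : ∀ l ∈ tt, γ l = 1) (wv : ι → Site 2)
    (hsh : ∀ l, d4ShiftSet (γ l) (wv l) Λ ⊆ Λ') (Y : ι → FermionOp Λ)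
    {ρ : Type*} (uu : Finset ρ) (b : ρ → ℂ) (cw : ρ → List (Orb (PolySite Λ') × Bool))
    (hcw : ∀ j ∈ uu, ladderCharge (cw j) ≠ 0 ∨ ladderSpinCharge (cw j) ≠ 0)
    {δ : Type*} (ah : Finset δ) (dc : δ → ℝ) (V : δ → FermionOp Λ')
    {κ'' : Type*} (w : Finset κ'') (a : κ'' → ℂ) (word : κ'' → List (Orb (PolySite Λ') × Bool)) {c : ℝ}
    (hcert : Xw - (c : ℂ) • (1 : FermionOp Λ') -
        ∑ σ : Fin 2, ((μ σ : ℝ) : ℂ) • (nAt 0 hz σ - ((ν : ℝ) : ℂ) • (1 : FermionOp Λ')) -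
        ((κ : ℝ) : ℂ) • (((u : ℝ) : ℂ) • (1 : FermionOp Λ') -
          fermionEmbed (PolySite.incl h0) ((hubbardTTPrimeFermionInteraction t t' UA).meanEnergyObs 1)) =
      gramForm Λm O +
        (∑ k ∈ s, ((hubbardTTPrimeFermionInteraction t t' UA).localHamiltonian Λ' * fermionEmbed (PolySite.incl hΛ) (B k) -
            fermionEmbed (PolySite.incl hΛ) (B k) * (hubbardTTPrimeFermionInteraction t t' UA).localHamiltonian Λ') +
          ∑ l ∈ tt, (fermionEmbed (PolySite.incl (hsh l)) (fermionEmbed (PolySite.d4Emb (γ l) (wv l) Λ) (Y l)) -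
            fermionEmbed (PolySite.incl hΛ) (Y l)) +
          ∑ j ∈ uu, b j • ladderWord (cw j)) +
        (∑ m' ∈ ah, ((dc m' : ℝ) : ℂ) • ((V m')ᴴ - V m') + ∑ k ∈ w, a k • ladderWord (word k)))
    {UP : ℝ} (hUP : UP ∈ Set.Icc U₁ U₂)
    {Ls : ℕ → ℕ} (hLs : Tendsto Ls atTop atTop)
    {ψ : ∀ L, Fock (Orb (FermionTorus 2 L))}
    (hψ : ∀ j, IsGroundStateInSector (hubbardTorusTT' (Ls j) t t' UP)
      (ThermodynamicLimit.rectN n (Ls j)) 0 (ψ (Ls j)))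
    (hψ1 : ∀ j, star (ψ (Ls j)) ⬝ᵥ ψ (Ls j) = 1)
    {ω : InfVolFermionState 2} (hω : ω.IsTorusLimitOf ψ Ls) :
    c + κ * (u - u') - ∑ k ∈ w, ‖a k‖ + (∑ σ : Fin 2, μ σ) * (n / 2 - ν) -
        |UA - UP| * (κ * (n / 2) ^ 2 + ‖∑ k ∈ s,
          ((hubbardTTPrimeFermionInteraction 0 0 1).localHamiltonian Λ' * fermionEmbed (PolySite.incl hΛ) (B k) -
            fermionEmbed (PolySite.incl hΛ) (B k) * (hubbardTTPrimeFermionInteraction 0 0 1).localHamiltonian Λ')‖) ≤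
      (ω.expect Λ' Xw).re :=
  have hUP0 : 0 < UP := hU₁.trans_le hUP.1
  have huP : ThermodynamicLimit.energyDensityTT' t t' UP n ≤ u' :=
    (energyDensityTT'_mono_U t t' hn0 hn2 hUP0.le hUP.2).trans hu'
  hω.re_expect_ge_of_window_certificate_TT'_ineq_transport_U_lipschitz t t' UA hUP0 hn0 hn2 hκ huP hΛ h8 h0
    hz Xw μ ν hΛm O s B tt γ hγ1 wv hsh Y uu b cw hcw ah dc V w a word hcert hLs hψ hψ1

end InfVolFermionState

end Literature.MathematicalPhysics.QuantumLattice
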